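import Literature.Barriers.FinalStateConjecture.NonSmoothNullInfinity
import Mathlib.Analysis.Calculus.ContDiff.Basic
import Mathlib.Analysis.Calculus.Deriv.Prod
import Mathlib.Analysis.Calculus.Deriv.Comp
import Mathlib.Analysis.Calculus.Deriv.Inverse
import Mathlib.Analysis.Calculus.FDeriv.Prod
import Mathlib.Analysis.Calculus.ParametricIntervalIntegral
import Mathlib.Analysis.Calculus.BumpFunction.Normed
import Mathlib.Analysis.Calculus.BumpFunction.InnerProduct
import Mathlib.Analysis.SpecialFunctions.Log.Deriv
import HarnessLib

/-!
# Barrier catalogue `FinalStateConjecture`: logarithmic asymptotics at `𝓘⁺` — uniqueness of the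
# scattering solution and the refutation of the journal-sign statement by the corrected one
(`Literature/Barriers/FinalStateConjecture/`, D-0021, D-0014; family `gr`; companion of
`NonSmoothNullInfinity.lean`, namespace `Literature.Barriers.FinalStateConjecture`)

`NonSmoothNullInfinity.lean` vendors Kehrberger's linear scattering theorem (arXiv:2105.08079,
Thm. 6.2 with Thm. 6.1) twice, as named facts existential in the radiation field `ψ = rφ`:
`KehrbergerLogarithmicAsymptotics`, whose clause (2) transcribes eq. (6.18) with the sign printed in
arXiv v1–v2 and in Ann. Henri Poincaré 23 (2022), `+(−1)ⁿ(3+n)! I⁽ⁿ⁾[G] M (log r − log|u|)/r^{4+n}`,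
and `KehrbergerLogarithmicAsymptoticsCorrected`, with the sign of the author-corrected arXiv v3
(29 Sep 2023; arXiv comments field and `changes.txt` of the v3 source: "(the same) sign mistake in
eqns. (4.45), (6.5), (6.18), and (B.2) fixed"; v3, Thm. 6.2, eq. (6.18):
"`∂ᵥ(rφ) = Σ_{i=0}^{n} f_i⁽ⁿ⁾(u)/r^{3+i} − (−1)ⁿ(3+n)! I⁽ⁿ⁾[G] M (log r − log|u|)/r^{4+n} + O(r^{−4−n})`").
That file proves that the two versions of clause (2) exclude each other *for one and the same
radiation field* (`KehrbergerLogarithmicAsymptotics.clause_two_exclusive`), but since both facts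
only assert the EXISTENCE of some radiation field with the stated properties, it left the relation
between the two declarations themselves at docstring level ("presumably false as stated").

This file closes that gap. It **proves**

* `IsRadiationFieldOnSchwarzschild.unique` — **uniqueness of the scattering solution in exactly
  the class used by the named facts**: two smooth solutions of
  `∂ᵤ∂ᵥψ = −2M(1 − 2M/r)ψ/r³` (`M > 0`, EF double null gauge, `IsEFAreaRadius M r`) which vanish on
  `{v ≤ v₁}` and have the same pointwise limits `ψ(u, v) → G(v)` as `u → −∞` coincide
  (`IsRadiationFieldOnSchwarzschild.eq_zero_of_tendsto_zero` for the homogeneous statement). No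
  finite-energy hypothesis is needed (the source's uniqueness clause, "in the class of
  finite-energy solutions", is quoted from the scattering theory of Dafermos–Rodnianski–
  Shlapentokh-Rothman for general solutions; here the problem is `1+1`-dimensional and the data
  class is smooth with pointwise limits). Consequently the radiation field whose existence either
  fact asserts is THE scattering solution, and the facts are no weaker for being existential.
* `isEFAreaRadius_stdEFAreaRadius` — an EF area radius exists for every `M > 0` (the inverse of
  the tortoise coordinate `r + 2M log(r − 2M) = v − u`, `stdEFAreaRadius`), and admissible
  scattering data exist (`scatteringBumpData`, a smooth bump supported in `[1/4, 3/4] ⊆ (0, 1)`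
  with `I⁽⁰⁾[G] = M ∫ G ≠ 0`, `n = 0`): the hypotheses of the facts are not vacuous.
* `KehrbergerLogarithmicAsymptotics.not_of_corrected :
  KehrbergerLogarithmicAsymptoticsCorrected → ¬ KehrbergerLogarithmicAsymptotics` — **the corrected
  fact refutes the journal-sign declaration** (instantiate both at `M = 1`, the standard radius, the
  bump data and `n = 0`; the two radiation fields coincide by uniqueness; for `u < min U₁ U₂` the two
  expansions of `∂ᵥψ(u, ·)` carry the opposite non-zero logarithmic coefficients `±3! I⁽⁰⁾[G]`, which
  `clause_two_exclusive` forbids). Hence `theorem KehrbergerLogarithmicAsymptotics_holds` can never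
  be landed unless Theorem 6.2 of the source (in its corrected form) is false: the declaration
  `KehrbergerLogarithmicAsymptotics` is MIS-STATED (wrong sign, D-0014: not edited in place; since the
  verdict clean-up of 2026-08-15 it is `@[deprecated KehrbergerLogarithmicAsymptoticsCorrected]`, kept
  verbatim only as the subject of these refutations), and the
  fact to cite, use as a hypothesis, and eventually discharge is
  `KehrbergerLogarithmicAsymptoticsCorrected` (whose barrier block and corollary
  `not_conformallySmooth` are unaffected; discharged since: `KehrbergerLogarithmicAsymptoticsCorrected_holds`,
  `NonSmoothNullInfinityCorrectedProofs.lean`).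
* `KehrbergerLogarithmicAsymptoticsCorrected.existsUnique` (under the corrected fact the radiation
  field with the stated support and data is unique: `∃!`) and
  `KehrbergerLogarithmicAsymptoticsCorrected.not_journalSign_expansion` (under the corrected fact,
  for EVERY admissible datum and the scattering solution, no expansion of `∂ᵥψ(u, ·)` with the
  journal sign of the logarithmic coefficient holds for early `u`, whatever the rational part).

## The uniqueness proof

Let `w` be a smooth solution with `w = 0` on `{v ≤ v₁}` and `w(u, v) → 0` as `u → −∞` for each `v`;
write `E = ∂ᵥw`, `V = −2M(1 − 2M/r)/r³` (`efPotential`), so that `∂ᵤE = Vw` and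
`w(u, x) = ∫_{v₁}^{x} E(u, ·)` (`eq_integral_partialV`). On `v ≥ v₁` one has `|V(u, v)| ≤ K(u) :=
2M/r(u, v₁)³` (`r(u, ·)` increases), and `K = ∂ᵤP` for the explicit weight
`P(u) = −(log(1 − 2M/r(u,v₁))/(2M) + 1/r(u,v₁)) ≥ 0`, `P → 0` as `u → −∞` (`efWeight`; this is
`∫_{−∞}^{u} K`, computed from `∂ᵤr = −(1 − 2M/r)`). For the slice energies
`Ψ_b(u) = ∫_{v₁}^{b} E(u, x)² dx` (`nullSliceEnergy`), differentiation under the integral sign and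
Cauchy–Schwarz (`w² ≤ (b − v₁)Ψ_b`) give the two-sided Grönwall inequality
`|Ψ_b'| ≤ (1 + (b − v₁)²) K Ψ_b` (`abs_deriv_nullSliceEnergy_le`), whence, with `c = 1 + (b − v₁)²`,
`Ψ_b e^{cP}` is non-decreasing and `Ψ_b e^{−cP}` non-increasing in `u`: `Ψ_b` is bounded towards the
past and `Ψ_b(u) ≤ Ψ_b(u') e^{cP(u)}` for `u' ≤ u`. Boundedness gives `|w| ≤ W₀`, so `|∂ᵤE| ≤ W₀K` and
`E(·, x)` is uniformly Cauchy towards `𝓘⁻`: `|E(u,x) − E(u',x)| ≤ W₀(P(u) − P(u'))`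
(`abs_partialV_sub_le`). The pointwise decay of `w = ∫E` then forces `|E(u, x)| ≤ W₀ P(u)`
(`abs_le_of_primitive_tendsto_zero`: otherwise `E(u', ·)` keeps a sign near `x` for all `u' ≤ u` and
`w(u', x + δ) − w(u', x)` cannot tend to `0`), so `Ψ_b(u') → 0` as `u' → −∞`, hence `Ψ_b ≡ 0` and
`w = 0`. Everything is elementary real analysis on Mathlib (`intervalIntegral`, parametric
differentiation `hasDerivAt_integral_of_dominated_loc_of_deriv_le`, `monotoneOn_of_deriv_nonneg`).

## References

* L. M. A. Kehrberger, *The case against smooth null infinity I: heuristics and counter-examples*,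
  Ann. Henri Poincaré 23 (2022) 829–921 = arXiv:2105.08079; author-corrected version
  arXiv:2105.08079v3 (2023), Thm. 6.2, eqs. (6.16)–(6.18), §6.2 eq. (6.14) (the equation),
  §3.2 (EF gauge, `∂ᵥr = −∂ᵤr = 1 − 2M/r`, tortoise coordinate). Key `Kehrberger2022AHP`.
* M. Dafermos, I. Rodnianski, Y. Shlapentokh-Rothman, *A scattering theory for the wave equation on
  Kerr black hole exteriors*, Ann. Sci. ÉNS 51 (2018) 371–486 (uniqueness of scattering solutions in
  the finite-energy class, cited by Kehrberger, Thm. 6.2). Key `DafermosRodnianskiShlapentokhrothman2018`.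
-/

noncomputable section

open Set Filter Topology MeasureTheory

namespace Literature.Barriers.FinalStateConjecture

/-! ### Calculus of slices of smooth functions of two real variables -/

/-- The slice `y ↦ F(x, y)` of a differentiable `F : ℝ × ℝ → ℝ` has derivative `DF(x,y)·(0,1)`.
[folklore] -/
lemma hasDerivAt_slice_snd {F : ℝ × ℝ → ℝ} {p : ℝ × ℝ} (hF : DifferentiableAt ℝ F p) :
    HasDerivAt (fun y ↦ F (p.1, y)) (fderiv ℝ F p (0, 1)) p.2 :=
  hF.hasFDerivAt.comp_hasDerivAt p.2 ((hasDerivAt_const p.2 p.1).prodMk (hasDerivAt_id p.2))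

/-- The slice `x ↦ F(x, y)` of a differentiable `F : ℝ × ℝ → ℝ` has derivative `DF(x,y)·(1,0)`.
[folklore] -/
lemma hasDerivAt_slice_fst {F : ℝ × ℝ → ℝ} {p : ℝ × ℝ} (hF : DifferentiableAt ℝ F p) :
    HasDerivAt (fun x ↦ F (x, p.2)) (fderiv ℝ F p (1, 0)) p.1 :=
  hF.hasFDerivAt.comp_hasDerivAt p.1 ((hasDerivAt_id p.1).prodMk (hasDerivAt_const p.1 p.2))

/-- The partial derivative `∂ᵥψ(u, v)` of a curried function of two variables, as the iterated
one-variable derivative used in `IsRadiationFieldOnSchwarzschild`. [folklore] -/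
def partialV (ψ : ℝ → ℝ → ℝ) : ℝ → ℝ → ℝ := fun u v ↦ deriv (fun v' ↦ ψ u v') v

/-- The partial derivative `∂ᵤψ(u, v)` of a curried function of two variables. [folklore] -/
def partialU (ψ : ℝ → ℝ → ℝ) : ℝ → ℝ → ℝ := fun u v ↦ deriv (fun u' ↦ ψ u' v) u

section Smooth

variable {ψ : ℝ → ℝ → ℝ}

/-- For jointly smooth `ψ`, `∂ᵥψ(u,v) = Dψ(u,v)·(0,1)`. [folklore] -/
lemma partialV_eq_fderiv (hψ : ContDiff ℝ ((⊤ : ℕ∞) : WithTop ℕ∞) (Function.uncurry ψ))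
    (u v : ℝ) : partialV ψ u v = fderiv ℝ (Function.uncurry ψ) (u, v) (0, 1) :=
  (hasDerivAt_slice_snd ((hψ.differentiable (by simp)) (u, v))).deriv

/-- For jointly smooth `ψ`, `∂ᵤψ(u,v) = Dψ(u,v)·(1,0)`. [folklore] -/
lemma partialU_eq_fderiv (hψ : ContDiff ℝ ((⊤ : ℕ∞) : WithTop ℕ∞) (Function.uncurry ψ))
    (u v : ℝ) : partialU ψ u v = fderiv ℝ (Function.uncurry ψ) (u, v) (1, 0) :=
  (hasDerivAt_slice_fst ((hψ.differentiable (by simp)) (u, v))).deriv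

/-- The `v`-slices of a jointly smooth `ψ` are differentiable with derivative `∂ᵥψ`. [folklore] -/
lemma hasDerivAt_partialV (hψ : ContDiff ℝ ((⊤ : ℕ∞) : WithTop ℕ∞) (Function.uncurry ψ))
    (u v : ℝ) : HasDerivAt (fun v' ↦ ψ u v') (partialV ψ u v) v := by
  rw [partialV_eq_fderiv hψ]
  exact hasDerivAt_slice_snd ((hψ.differentiable (by simp)) (u, v))

/-- The `u`-slices of a jointly smooth `ψ` are differentiable with derivative `∂ᵤψ`. [folklore] -/
lemma hasDerivAt_partialU (hψ : ContDiff ℝ ((⊤ : ℕ∞) : WithTop ℕ∞) (Function.uncurry ψ))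
    (u v : ℝ) : HasDerivAt (fun u' ↦ ψ u' v) (partialU ψ u v) u := by
  rw [partialU_eq_fderiv hψ]
  exact hasDerivAt_slice_fst ((hψ.differentiable (by simp)) (u, v))

/-- `∂ᵥψ` of a jointly smooth `ψ` is jointly smooth. [folklore] -/
lemma contDiff_partialV (hψ : ContDiff ℝ ((⊤ : ℕ∞) : WithTop ℕ∞) (Function.uncurry ψ)) :
    ContDiff ℝ ((⊤ : ℕ∞) : WithTop ℕ∞) (Function.uncurry (partialV ψ)) := by
  have h : Function.uncurry (partialV ψ) =
      fun p : ℝ × ℝ ↦ fderiv ℝ (Function.uncurry ψ) p (0, 1) := by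
    funext p
    exact partialV_eq_fderiv hψ p.1 p.2
  rw [h]
  exact (contDiff_infty_iff_fderiv.1 hψ).2.clm_apply contDiff_const

/-- `∂ᵤψ` of a jointly smooth `ψ` is jointly smooth. [folklore] -/
lemma contDiff_partialU (hψ : ContDiff ℝ ((⊤ : ℕ∞) : WithTop ℕ∞) (Function.uncurry ψ)) :
    ContDiff ℝ ((⊤ : ℕ∞) : WithTop ℕ∞) (Function.uncurry (partialU ψ)) := by
  have h : Function.uncurry (partialU ψ) =
      fun p : ℝ × ℝ ↦ fderiv ℝ (Function.uncurry ψ) p (1, 0) := by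
    funext p
    exact partialU_eq_fderiv hψ p.1 p.2
  rw [h]
  exact (contDiff_infty_iff_fderiv.1 hψ).2.clm_apply contDiff_const

/-- Slices `F(u, ·)` of a jointly continuous function are continuous. [folklore] -/
lemma continuous_slice_snd {F : ℝ → ℝ → ℝ} (hF : Continuous (Function.uncurry F)) (u : ℝ) :
    Continuous (F u) :=
  hF.comp (continuous_const.prodMk continuous_id)

end Smooth

/-! ### The EF area radius: elementary properties -/

namespace IsEFAreaRadius

variable {M : ℝ} {r : ℝ → ℝ → ℝ}

/-- `∂ᵥr = 1 − 2M/r`. [cite: Kehrberger2022AHP, §3.2 and §6.2] -/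
lemma hasDerivAt_snd (hr : IsEFAreaRadius M r) (u v : ℝ) :
    HasDerivAt (fun v' ↦ r u v') (1 - 2 * M / r u v) v := hr.2.1 u v

/-- `∂ᵤr = −(1 − 2M/r)`. [cite: Kehrberger2022AHP, §3.2 and §6.2] -/
lemma hasDerivAt_fst (hr : IsEFAreaRadius M r) (u v : ℝ) :
    HasDerivAt (fun u' ↦ r u' v) (-(1 - 2 * M / r u v)) u := hr.2.2 u v

/-- `r > 0` (as `r > 2M ≥ 0`). [folklore] -/
lemma pos (hr : IsEFAreaRadius M r) (hM : 0 ≤ M) (u v : ℝ) : 0 < r u v :=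
  lt_of_le_of_lt (by linarith) (hr.1 u v)

/-- `1 − 2M/r > 0` on the exterior. [folklore] -/
lemma factor_pos (hr : IsEFAreaRadius M r) (hM : 0 ≤ M) (u v : ℝ) : 0 < 1 - 2 * M / r u v := by
  rw [sub_pos, div_lt_one (hr.pos hM u v)]
  exact hr.1 u v

/-- `1 − 2M/r ≤ 1`. [folklore] -/
lemma factor_le_one (hr : IsEFAreaRadius M r) (hM : 0 ≤ M) (u v : ℝ) :
    1 - 2 * M / r u v ≤ 1 := by
  have := div_nonneg (by linarith : (0 : ℝ) ≤ 2 * M) (hr.pos hM u v).le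
  linarith

/-- `r(u, ·)` is continuous. [folklore] -/
lemma continuous_snd (hr : IsEFAreaRadius M r) (u : ℝ) : Continuous (fun v ↦ r u v) :=
  continuous_iff_continuousAt.2 fun v ↦ (hr.hasDerivAt_snd u v).continuousAt

/-- `r(u, ·)` is non-decreasing (`∂ᵥr = 1 − 2M/r > 0`). [folklore] -/
lemma monotone_snd (hr : IsEFAreaRadius M r) (hM : 0 ≤ M) (u : ℝ) : Monotone (fun v ↦ r u v) :=
  monotone_of_deriv_nonneg (fun v ↦ (hr.hasDerivAt_snd u v).differentiableAt) fun v ↦ by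
    rw [(hr.hasDerivAt_snd u v).deriv]; exact (hr.factor_pos hM u v).le

/-- The reflection `(u, v) ↦ r(−v, −u)` of an EF area radius is again one (the discrete isometry
`t ↦ −t` of Schwarzschild exchanges the two null coordinates). [folklore] -/
lemma reflect (hr : IsEFAreaRadius M r) : IsEFAreaRadius M (fun u v ↦ r (-v) (-u)) := by
  refine ⟨fun u v ↦ hr.1 _ _, fun u v ↦ ?_, fun u v ↦ ?_⟩
  · have h : HasDerivAt (fun v' ↦ r (-v') (-u)) (-(1 - 2 * M / r (-v) (-u)) * -1) v :=
      (hr.hasDerivAt_fst (-v) (-u)).comp v (hasDerivAt_neg v)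
    exact h.congr_deriv (by ring)
  · have h : HasDerivAt (fun u' ↦ r (-v) (-u')) ((1 - 2 * M / r (-v) (-u)) * -1) u :=
      (hr.hasDerivAt_snd (-v) (-u)).comp u (hasDerivAt_neg u)
    exact h.congr_deriv (by ring)

/-- Along each ingoing null line `v = const` the area radius tends to infinity towards the past,
`r(u, v) → ∞` as `u → −∞` (approach to `𝓘⁻ = {u = −∞}`); from `IsEFAreaRadius.tendsto_atTop`
by reflection. [cite: Kehrberger2022AHP, §3.2] -/
theorem tendsto_atBot (hr : IsEFAreaRadius M r) (hM : 0 ≤ M) (v : ℝ) :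
    Tendsto (fun u ↦ r u v) atBot atTop := by
  have h := (hr.reflect.tendsto_atTop hM (-v)).comp tendsto_neg_atBot_atTop
  refine h.congr fun u ↦ ?_
  simp

end IsEFAreaRadius

/-! ### Linear structure of the space of radiation fields -/

/-- The potential `V(u, v) = −2M(1 − 2M/r)/r³` of the radiation-field equation `∂ᵤ∂ᵥψ = Vψ`
(Kehrberger, arXiv:2105.08079v3, §6.2, eq. (6.14)). [cite: Kehrberger2022AHP, §6.2 eq. (6.14)] -/
def efPotential (M : ℝ) (r : ℝ → ℝ → ℝ) (u v : ℝ) : ℝ :=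
  -2 * M * (1 - 2 * M / r u v) / r u v ^ 3

namespace IsRadiationFieldOnSchwarzschild

variable {M : ℝ} {r ψ ψ₁ ψ₂ : ℝ → ℝ → ℝ}

/-- The radiation-field equation in the form `∂ᵤ(∂ᵥψ) = V ψ`. [cite: Kehrberger2022AHP, §6.2 eq. (6.14)] -/
lemma partialU_partialV (h : IsRadiationFieldOnSchwarzschild M r ψ) (u v : ℝ) :
    partialU (partialV ψ) u v = efPotential M r u v * ψ u v := by
  simp only [partialU, partialV, efPotential]
  rw [h.2 u v]
  ring

/-- The difference of two radiation fields (same mass, same area radius) is a radiation field: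
the equation is linear. [folklore] -/
lemma sub (h₁ : IsRadiationFieldOnSchwarzschild M r ψ₁)
    (h₂ : IsRadiationFieldOnSchwarzschild M r ψ₂) :
    IsRadiationFieldOnSchwarzschild M r (ψ₁ - ψ₂) := by
  refine ⟨?_, fun u v ↦ ?_⟩
  · have : Function.uncurry (ψ₁ - ψ₂) = Function.uncurry ψ₁ - Function.uncurry ψ₂ := by
      funext p; rfl
    rw [this]
    exact h₁.1.sub h₂.1
  · have hv : ∀ u', deriv (fun v' ↦ (ψ₁ - ψ₂) u' v') v = partialV ψ₁ u' v - partialV ψ₂ u' v := by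
      intro u'
      exact ((hasDerivAt_partialV h₁.1 u' v).sub (hasDerivAt_partialV h₂.1 u' v)).deriv
    simp_rw [hv]
    have hu := ((hasDerivAt_partialU (contDiff_partialV h₁.1) u v).sub
      (hasDerivAt_partialU (contDiff_partialV h₂.1) u v)).deriv
    have hu' : deriv (fun u' ↦ partialV ψ₁ u' v - partialV ψ₂ u' v) u =
        partialU (partialV ψ₁) u v - partialU (partialV ψ₂) u v := hu
    rw [hu', h₁.partialU_partialV, h₂.partialU_partialV]
    simp only [efPotential, Pi.sub_apply]
    ring

end IsRadiationFieldOnSchwarzschild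

/-! ### Uniqueness of the scattering solution: energy-type estimates on outgoing null segments -/

/-- The elementary Cauchy–Schwarz inequality `(∫ₐˣ f)² ≤ (x − a) ∫ₐˣ f²` for continuous `f` and
`a ≤ x` (from `0 ≤ ∫ₐˣ (f − c)²` with `c` the mean of `f`). [folklore] -/
lemma sq_integral_le_mul_integral_sq {f : ℝ → ℝ} (hf : Continuous f) {a x : ℝ} (hax : a ≤ x) :
    (∫ t in a..x, f t) ^ 2 ≤ (x - a) * ∫ t in a..x, f t ^ 2 := by
  rcases eq_or_lt_of_le hax with rfl | hlt
  · simp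
  · set c := (∫ t in a..x, f t) / (x - a) with hc
    have hxa : 0 < x - a := sub_pos.2 hlt
    have h0 : 0 ≤ ∫ t in a..x, (f t - c) ^ 2 :=
      intervalIntegral.integral_nonneg hax fun t _ ↦ sq_nonneg _
    have hexp : ∫ t in a..x, (f t - c) ^ 2 =
        (∫ t in a..x, f t ^ 2) - 2 * c * (∫ t in a..x, f t) + (x - a) * c ^ 2 := by
      have h1 : ∫ t in a..x, (f t - c) ^ 2 = ∫ t in a..x, (f t ^ 2 - 2 * c * f t + c ^ 2) := by
        refine intervalIntegral.integral_congr fun t _ ↦ ?_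
        ring
      have i1 : IntervalIntegrable (fun t ↦ f t ^ 2) volume a x := (hf.pow 2).intervalIntegrable _ _
      have i2 : IntervalIntegrable (fun t ↦ 2 * c * f t) volume a x :=
        (hf.const_mul _).intervalIntegrable _ _
      have i3 : IntervalIntegrable (fun t ↦ f t ^ 2 - 2 * c * f t) volume a x := i1.sub i2
      have i4 : IntervalIntegrable (fun _ ↦ c ^ 2) volume a x := intervalIntegrable_const
      rw [h1, intervalIntegral.integral_add i3 i4, intervalIntegral.integral_sub i1 i2,
        intervalIntegral.integral_const_mul, intervalIntegral.integral_const, smul_eq_mul]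
    have hI : ∫ t in a..x, f t = c * (x - a) := by
      rw [hc]; field_simp
    rw [hexp, hI] at h0
    rw [hI]
    nlinarith [h0, hxa]

/-- If a continuous function `e(u', ·)` stays uniformly `m`-close to `e(u, ·)` on `[x₀, x₀ + δ₀]`
for all earlier times `u' ≤ u`, while its primitives `F(u', ·)` tend to `0` pointwise as
`u' → −∞`, then `|e(u, x₀)| ≤ m`: otherwise `e(u', ·)` would keep a definite sign and size near
`x₀`, so `F(u', x₀ + δ) − F(u', x₀) = ∫ e(u', ·)` could not tend to `0`. [folklore] -/
lemma abs_le_of_primitive_tendsto_zero {e F : ℝ → ℝ → ℝ} {u x₀ δ₀ m : ℝ} (hδ₀ : 0 < δ₀)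
    (hcont : ∀ u', Continuous (e u'))
    (hnear : ∀ u' ≤ u, ∀ y ∈ Icc x₀ (x₀ + δ₀), |e u' y - e u y| ≤ m)
    (hF : ∀ u' ≤ u, ∀ y ∈ Icc x₀ (x₀ + δ₀), F u' y - F u' x₀ = ∫ t in x₀..y, e u' t)
    (hlim : ∀ y ∈ Icc x₀ (x₀ + δ₀), Tendsto (fun u' ↦ F u' y) atBot (𝓝 0)) :
    |e u x₀| ≤ m := by
  by_contra hcon
  have hcon' : m < |e u x₀| := not_le.1 hcon
  set a := e u x₀ with ha
  set ε := |a| - m with hε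
  have hεpos : 0 < ε := by rw [hε]; linarith [hcon']
  obtain ⟨δ, hδ, hδ'⟩ := Metric.continuousAt_iff.1 (hcont u).continuousAt (ε / 2) (by linarith)
  set δ' := min (δ / 2) δ₀ with hδ'def
  have hδ'pos : 0 < δ' := lt_min (by linarith) hδ₀
  have hδ'le : δ' ≤ δ₀ := min_le_right _ _
  have hsub : Icc x₀ (x₀ + δ') ⊆ Icc x₀ (x₀ + δ₀) := Icc_subset_Icc le_rfl (by linarith)
  -- on `[x₀, x₀ + δ']` and for `u' ≤ u`, `a · e(u', t) ≥ |a| ε / 2`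
  have key : ∀ u' ≤ u, ∀ t ∈ Icc x₀ (x₀ + δ'), |a| * (ε / 2) ≤ a * e u' t := by
    intro u' hu' t ht
    have h1 : |e u t - a| < ε / 2 := by
      have : dist t x₀ < δ := by
        rw [Real.dist_eq, abs_of_nonneg (by linarith [ht.1])]
        linarith [ht.2, min_le_left (δ / 2) δ₀]
      have := hδ' this
      rwa [Real.dist_eq] at this
    have h2 : |e u' t - a| ≤ |a| - ε / 2 := by
      calc |e u' t - a| = |(e u' t - e u t) + (e u t - a)| := by ring_nf
        _ ≤ |e u' t - e u t| + |e u t - a| := abs_add_le _ _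
        _ ≤ m + ε / 2 := add_le_add (hnear u' hu' t (hsub ht)) h1.le
        _ = |a| - ε / 2 := by rw [hε]; ring
    have h3 : a * e u' t = a ^ 2 + a * (e u' t - a) := by ring
    have h4 : -(|a| * |e u' t - a|) ≤ a * (e u' t - a) := by
      rw [← abs_mul]; exact neg_abs_le _
    have h5 : |a| * |e u' t - a| ≤ |a| * (|a| - ε / 2) :=
      mul_le_mul_of_nonneg_left h2 (abs_nonneg a)
    have h6 : a ^ 2 = |a| ^ 2 := (sq_abs a).symm
    nlinarith [h3, h4, h5, h6, abs_nonneg a]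
  -- hence the integrals over `[x₀, x₀ + δ']` are bounded below
  have hint : ∀ u' ≤ u, δ' * (|a| * (ε / 2)) ≤ a * (F u' (x₀ + δ') - F u' x₀) := by
    intro u' hu'
    have hmem : x₀ + δ' ∈ Icc x₀ (x₀ + δ₀) := ⟨by linarith, by linarith⟩
    rw [hF u' hu' _ hmem, ← intervalIntegral.integral_const_mul]
    have i1 : IntervalIntegrable (fun _ ↦ |a| * (ε / 2)) volume x₀ (x₀ + δ') :=
      intervalIntegrable_const
    have i2 : IntervalIntegrable (fun t ↦ a * e u' t) volume x₀ (x₀ + δ') :=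
      ((hcont u').const_mul a).intervalIntegrable _ _
    have := intervalIntegral.integral_mono_on (by linarith : x₀ ≤ x₀ + δ') i1 i2 (key u' hu')
    rwa [intervalIntegral.integral_const, smul_eq_mul, add_sub_cancel_left] at this
  -- but they tend to `0`
  have hpos : 0 < δ' * (|a| * (ε / 2)) := by
    have : 0 < |a| := by
      have := abs_nonneg a; rw [hε] at hεpos
      by_contra h
      have h' : |a| ≤ 0 := not_lt.1 h
      have hm : 0 ≤ m := by
        have := hnear u le_rfl x₀ ⟨le_rfl, by linarith⟩
        exact (abs_nonneg _).trans this
      linarith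
    positivity
  have hmem₁ : x₀ + δ' ∈ Icc x₀ (x₀ + δ₀) := ⟨by linarith, by linarith⟩
  have hmem₀ : x₀ ∈ Icc x₀ (x₀ + δ₀) := ⟨le_rfl, by linarith⟩
  have hT : Tendsto (fun u' ↦ a * (F u' (x₀ + δ') - F u' x₀)) atBot (𝓝 (a * (0 - 0))) :=
    ((hlim _ hmem₁).sub (hlim _ hmem₀)).const_mul a
  rw [sub_zero, mul_zero] at hT
  obtain ⟨u', hu'₁, hu'₂⟩ :=
    ((hT.eventually (gt_mem_nhds hpos)).and (eventually_le_atBot u)).exists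
  exact absurd (hint u' hu'₂) (not_le.2 hu'₁)

section Uniqueness

variable {M : ℝ} {r w : ℝ → ℝ → ℝ} {v₁ : ℝ}

/-- `K(u) = 2M/r(u,v₁)³`, a bound for `|V(u, v)|` on `v ≥ v₁`. [folklore] -/
def efPotentialBound (M : ℝ) (r : ℝ → ℝ → ℝ) (v₁ u : ℝ) : ℝ := 2 * M / r u v₁ ^ 3

/-- The weight `P(u) = −(log(1 − 2M/r(u,v₁))/(2M) + 1/r(u,v₁))`, a primitive of `K` along the
ingoing direction (`∂ᵤP = 2M/r³` because `∂ᵤr = −(1 − 2M/r)`), non-negative and tending to `0`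
towards `𝓘⁻`. [folklore] -/
def efWeight (M : ℝ) (r : ℝ → ℝ → ℝ) (v₁ u : ℝ) : ℝ :=
  -(Real.log (1 - 2 * M / r u v₁) / (2 * M) + (r u v₁)⁻¹)

/-- The energy of the slice `{u} × [v₁, b]`: `Ψ_b(u) = ∫_{v₁}^{b} (∂ᵥw)(u, x)² dx`. [folklore] -/
def nullSliceEnergy (w : ℝ → ℝ → ℝ) (v₁ b u : ℝ) : ℝ := ∫ x in v₁..b, partialV w u x ^ 2

/-- `|V| ≤ 2M/r³`. [folklore] -/
lemma abs_efPotential_le (hM : 0 < M) (hr : IsEFAreaRadius M r) (u v : ℝ) :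
    |efPotential M r u v| ≤ 2 * M / r u v ^ 3 := by
  have hr0 := hr.pos hM.le u v
  have hf0 := hr.factor_pos hM.le u v
  have hf1 := hr.factor_le_one hM.le u v
  have h3 : 0 < r u v ^ 3 := pow_pos hr0 3
  rw [efPotential, abs_div, abs_of_pos h3, div_le_div_iff_of_pos_right h3]
  rw [show -2 * M * (1 - 2 * M / r u v) = -(2 * M * (1 - 2 * M / r u v)) by ring, abs_neg,
    abs_of_pos (by positivity)]
  nlinarith

/-- `|V(u, v)| ≤ K(u) = 2M/r(u, v₁)³` for `v ≥ v₁` (`r(u, ·)` increases). [folklore] -/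
lemma abs_efPotential_le_bound (hM : 0 < M) (hr : IsEFAreaRadius M r) (u : ℝ) {v : ℝ}
    (hv : v₁ ≤ v) : |efPotential M r u v| ≤ efPotentialBound M r v₁ u := by
  refine (abs_efPotential_le hM hr u v).trans ?_
  rw [efPotentialBound]
  have h1 : 0 < r u v₁ := hr.pos hM.le u v₁
  have hmono : r u v₁ ≤ r u v := hr.monotone_snd hM.le u hv
  exact div_le_div_of_nonneg_left (by linarith) (pow_pos h1 3)
    (pow_le_pow_left₀ h1.le hmono 3)

/-- The crude global bound `|V| ≤ 1/(4M²)` (from `r > 2M`). [folklore] -/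
lemma abs_efPotential_le_const (hM : 0 < M) (hr : IsEFAreaRadius M r) (u v : ℝ) :
    |efPotential M r u v| ≤ 1 / (4 * M ^ 2) := by
  refine (abs_efPotential_le hM hr u v).trans ?_
  have h2 : 2 * M < r u v := hr.1 u v
  have h8 : (2 * M) ^ 3 ≤ r u v ^ 3 := pow_le_pow_left₀ (by linarith) h2.le 3
  rw [div_le_div_iff₀ (pow_pos (hr.pos hM.le u v) 3) (by positivity)]
  nlinarith

/-- `K ≥ 0`. [folklore] -/
lemma efPotentialBound_nonneg (hM : 0 < M) (hr : IsEFAreaRadius M r) (u : ℝ) :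
    0 ≤ efPotentialBound M r v₁ u :=
  div_nonneg (by linarith) (pow_pos (hr.pos hM.le u v₁) 3).le

/-- `V(u, ·)` is continuous. [folklore] -/
lemma continuous_efPotential_snd (hM : 0 < M) (hr : IsEFAreaRadius M r) (u : ℝ) :
    Continuous (fun v ↦ efPotential M r u v) := by
  have hc := hr.continuous_snd u
  have hne : ∀ v, r u v ≠ 0 := fun v ↦ (hr.pos hM.le u v).ne'
  unfold efPotential
  refine Continuous.div ?_ (hc.pow 3) fun v ↦ pow_ne_zero 3 (hne v)
  exact continuous_const.mul (continuous_const.sub (continuous_const.div hc hne))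

/-- `∂ᵤP = K`: `P` is a primitive of `2M/r(·, v₁)³` because `∂ᵤr = −(1 − 2M/r)`. [folklore] -/
lemma hasDerivAt_efWeight (hM : 0 < M) (hr : IsEFAreaRadius M r) (u : ℝ) :
    HasDerivAt (efWeight M r v₁) (efPotentialBound M r v₁ u) u := by
  have hρ : HasDerivAt (fun u' ↦ r u' v₁) (-(1 - 2 * M / r u v₁)) u := hr.hasDerivAt_fst u v₁
  have hr0 : r u v₁ ≠ 0 := (hr.pos hM.le u v₁).ne'
  have hf0 : 1 - 2 * M / r u v₁ ≠ 0 := (hr.factor_pos hM.le u v₁).ne'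
  have hM0 : (2 * M) ≠ 0 := by positivity
  have h2M : r u v₁ - 2 * M ≠ 0 := sub_ne_zero.2 (ne_of_gt (hr.1 u v₁))
  have h2M' : r u v₁ - M * 2 ≠ 0 := by rwa [mul_comm] at h2M
  have hinv : HasDerivAt (fun u' ↦ (r u' v₁)⁻¹) (-(-(1 - 2 * M / r u v₁)) / r u v₁ ^ 2) u :=
    hρ.inv hr0
  -- derivative of `1 - 2M/ρ = 1 - 2M · ρ⁻¹`
  have h1 : HasDerivAt (fun u' ↦ 1 - 2 * M / r u' v₁)
      (0 - 2 * M * (-(-(1 - 2 * M / r u v₁)) / r u v₁ ^ 2)) u := by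
    have h' : HasDerivAt (fun u' ↦ 1 - 2 * M * (r u' v₁)⁻¹)
        (0 - 2 * M * (-(-(1 - 2 * M / r u v₁)) / r u v₁ ^ 2)) u :=
      (hasDerivAt_const u (1 : ℝ)).sub (hinv.const_mul (2 * M))
    refine h'.congr_of_eventuallyEq (Eventually.of_forall fun u' ↦ ?_)
    simp [div_eq_mul_inv]
  have h2 := h1.log hf0
  have h3 := h2.div_const (2 * M)
  have h5 := (h3.add hinv).neg
  refine h5.congr_deriv ?_
  rw [efPotentialBound]
  field_simp
  ring

/-- `P ≥ 0` (`log(1 − x) ≤ −x`). [folklore] -/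
lemma efWeight_nonneg (hM : 0 < M) (hr : IsEFAreaRadius M r) (u : ℝ) : 0 ≤ efWeight M r v₁ u := by
  rw [efWeight]
  have hf := hr.factor_pos hM.le u v₁
  have hlog : Real.log (1 - 2 * M / r u v₁) ≤ -(2 * M / r u v₁) := by
    have := Real.log_le_sub_one_of_pos hf
    linarith
  have h1 : Real.log (1 - 2 * M / r u v₁) / (2 * M) ≤ -(r u v₁)⁻¹ := by
    rw [div_le_iff₀ (by positivity : (0:ℝ) < 2 * M)]
    have : -(r u v₁)⁻¹ * (2 * M) = -(2 * M / r u v₁) := by rw [div_eq_mul_inv]; ring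
    linarith
  linarith

/-- `P(u) → 0` as `u → −∞` (`r(u, v₁) → ∞` towards `𝓘⁻`). [folklore] -/
lemma tendsto_efWeight_atBot (hM : 0 < M) (hr : IsEFAreaRadius M r) :
    Tendsto (efWeight M r v₁) atBot (𝓝 0) := by
  have hρ := hr.tendsto_atBot hM.le v₁
  have hinv : Tendsto (fun u ↦ (r u v₁)⁻¹) atBot (𝓝 0) := hρ.inv_tendsto_atTop
  have h1 : Tendsto (fun u ↦ 1 - 2 * M / r u v₁) atBot (𝓝 (1 - 2 * M * 0)) := by
    simpa [div_eq_mul_inv] using tendsto_const_nhds.sub (hinv.const_mul (2 * M))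
  rw [mul_zero, sub_zero] at h1
  have h2 : Tendsto (fun u ↦ Real.log (1 - 2 * M / r u v₁)) atBot (𝓝 (Real.log 1)) :=
    (Real.continuousAt_log one_ne_zero).tendsto.comp h1
  rw [Real.log_one] at h2
  have h3 := ((h2.div_const (2 * M)).add hinv).neg
  rw [zero_div, add_zero, neg_zero] at h3
  exact h3

namespace IsRadiationFieldOnSchwarzschild

/-- `∂ᵥw(u, ·)` is continuous. [folklore] -/
lemma continuous_partialV_snd (hw : IsRadiationFieldOnSchwarzschild M r w) (u : ℝ) :
    Continuous (partialV w u) :=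
  continuous_slice_snd (contDiff_partialV hw.1).continuous u

/-- `w(u, ·)` is continuous. [folklore] -/
lemma continuous_snd (hw : IsRadiationFieldOnSchwarzschild M r w) (u : ℝ) : Continuous (w u) :=
  continuous_slice_snd hw.1.continuous u

/-- The equation as a `u`-derivative statement for `∂ᵥw(·, x)`: `∂ᵤ(∂ᵥw) = Vw`. [folklore] -/
lemma hasDerivAt_partialV_fst (hw : IsRadiationFieldOnSchwarzschild M r w) (u x : ℝ) :
    HasDerivAt (fun u' ↦ partialV w u' x) (efPotential M r u x * w u x) u := by
  have h := hasDerivAt_partialU (contDiff_partialV hw.1) u x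
  rwa [hw.partialU_partialV] at h

/-- A radiation field vanishing on `{v ≤ v₁}` is the `v`-primitive of `∂ᵥw` from `v₁`:
`w(u, v) = ∫_{v₁}^{v} ∂ᵥw(u, x) dx`. [folklore] -/
lemma eq_integral_partialV (hw : IsRadiationFieldOnSchwarzschild M r w)
    (hz : ∀ u v, v ≤ v₁ → w u v = 0) (u v : ℝ) :
    w u v = ∫ x in v₁..v, partialV w u x := by
  have hc : Continuous (partialV w u) := continuous_slice_snd (contDiff_partialV hw.1).continuous u
  rw [intervalIntegral.integral_eq_sub_of_hasDerivAt (fun x _ ↦ hasDerivAt_partialV hw.1 u x)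
    (hc.intervalIntegrable _ _), hz u v₁ le_rfl, sub_zero]


/-- `Ψ_b ≥ 0` for `b ≥ v₁`. [folklore] -/
lemma nullSliceEnergy_nonneg {b : ℝ} (hb : v₁ ≤ b) (u : ℝ) : 0 ≤ nullSliceEnergy w v₁ b u :=
  intervalIntegral.integral_nonneg hb fun _ _ ↦ sq_nonneg _

/-- `w(u, x)² ≤ (b − v₁) Ψ_b(u)` for `x ∈ [v₁, b]` (Cauchy–Schwarz). [folklore] -/
lemma sq_le_mul_nullSliceEnergy (hw : IsRadiationFieldOnSchwarzschild M r w)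
    (hz : ∀ u v, v ≤ v₁ → w u v = 0) {b : ℝ} (u : ℝ) {x : ℝ}
    (hx : x ∈ Icc v₁ b) : w u x ^ 2 ≤ (b - v₁) * nullSliceEnergy w v₁ b u := by
  have hc : Continuous (partialV w u) := continuous_slice_snd (contDiff_partialV hw.1).continuous u
  rw [eq_integral_partialV hw hz u x]
  refine (sq_integral_le_mul_integral_sq hc hx.1).trans ?_
  have hxb : x ≤ b := hx.2
  have h1 : ∫ t in v₁..x, partialV w u t ^ 2 ≤ nullSliceEnergy w v₁ b u :=
    intervalIntegral.integral_mono_interval le_rfl hx.1 hxb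
      (Eventually.of_forall fun t ↦ sq_nonneg _) ((hc.pow 2).intervalIntegrable _ _)
  have h2 : 0 ≤ ∫ t in v₁..x, partialV w u t ^ 2 :=
    intervalIntegral.integral_nonneg hx.1 fun t _ ↦ sq_nonneg _
  nlinarith [h1, h2, hx.1, hxb]

/-- Differentiation under the integral sign: `Ψ_b'(u) = ∫_{v₁}^{b} 2 ∂ᵥw · V w`. [folklore] -/
lemma hasDerivAt_nullSliceEnergy (hM : 0 < M) (hr : IsEFAreaRadius M r)
    (hw : IsRadiationFieldOnSchwarzschild M r w) (b u : ℝ) :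
    HasDerivAt (nullSliceEnergy w v₁ b)
      (∫ x in v₁..b, 2 * partialV w u x * (efPotential M r u x * w u x)) u := by
  have hEc : Continuous (Function.uncurry (partialV w)) := (contDiff_partialV hw.1).continuous
  have hwc : Continuous (Function.uncurry w) := hw.1.continuous
  -- a uniform bound for the derivative on `closedBall u 1 × [v₁, b]`
  obtain ⟨C, hC⟩ := ((isCompact_closedBall u 1).prod (isCompact_uIcc (a := v₁) (b := b)))
    |>.exists_bound_of_continuousOn (f := fun p : ℝ × ℝ ↦
      2 * |Function.uncurry (partialV w) p| * (1 / (4 * M ^ 2)) * |Function.uncurry w p|)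
      (by fun_prop)
  have key := intervalIntegral.hasDerivAt_integral_of_dominated_loc_of_deriv_le
    (𝕜 := ℝ) (μ := volume) (a := v₁) (b := b) (bound := fun _ ↦ C)
    (F := fun u' x ↦ partialV w u' x ^ 2)
    (F' := fun u' x ↦ 2 * partialV w u' x * (efPotential M r u' x * w u' x)) (x₀ := u)
    (Metric.ball_mem_nhds u one_pos) ?_ ?_ ?_ ?_ ?_ ?_
  · exact key.2
  · exact Eventually.of_forall fun u' ↦
      ((hw.continuous_partialV_snd u').pow 2).aestronglyMeasurable
  · exact ((hw.continuous_partialV_snd u).pow 2).intervalIntegrable _ _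
  · exact (((hw.continuous_partialV_snd u).const_mul 2).mul
      ((continuous_efPotential_snd hM hr u).mul (hw.continuous_snd u))).aestronglyMeasurable
  · refine Eventually.of_forall fun x hx u' hu' ↦ ?_
    have hV := abs_efPotential_le_const hM hr u' x
    have hmem : (u', x) ∈ Metric.closedBall u 1 ×ˢ uIcc v₁ b :=
      ⟨Metric.ball_subset_closedBall hu', uIoc_subset_uIcc hx⟩
    have hCx := hC (u', x) hmem
    simp only [Function.uncurry_apply_pair] at hCx
    rw [Real.norm_eq_abs, abs_of_nonneg (by positivity)] at hCx
    rw [Real.norm_eq_abs]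
    calc |2 * partialV w u' x * (efPotential M r u' x * w u' x)|
        = 2 * |partialV w u' x| * |efPotential M r u' x| * |w u' x| := by
          simp only [abs_mul, abs_two]; ring
      _ ≤ 2 * |partialV w u' x| * (1 / (4 * M ^ 2)) * |w u' x| := by
          gcongr
      _ ≤ C := hCx
  · exact intervalIntegrable_const
  · refine Eventually.of_forall fun x _ u' _ ↦ ?_
    have h := (hw.hasDerivAt_partialV_fst u' x).pow 2
    refine h.congr_deriv ?_
    simp only [Nat.cast_ofNat, Nat.add_one_sub_one, pow_one]

/-- The two-sided Grönwall inequality `|Ψ_b'(u)| ≤ (1 + (b − v₁)²) K(u) Ψ_b(u)`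
(`2|∂ᵥw||V||w| ≤ K((∂ᵥw)² + w²)` and `∫ w² ≤ (b − v₁)² Ψ_b`). [folklore] -/
lemma abs_deriv_nullSliceEnergy_le (hM : 0 < M) (hr : IsEFAreaRadius M r)
    (hw : IsRadiationFieldOnSchwarzschild M r w) (hz : ∀ u v, v ≤ v₁ → w u v = 0) {b : ℝ}
    (hb : v₁ ≤ b) (u : ℝ) :
    |∫ x in v₁..b, 2 * partialV w u x * (efPotential M r u x * w u x)| ≤
      (1 + (b - v₁) ^ 2) * efPotentialBound M r v₁ u * nullSliceEnergy w v₁ b u := by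
  set K := efPotentialBound M r v₁ u with hK
  have hK0 : 0 ≤ K := efPotentialBound_nonneg hM hr u
  have hEc := hw.continuous_partialV_snd u
  have hwc := hw.continuous_snd u
  have hVc := continuous_efPotential_snd hM hr u
  have i1 : IntervalIntegrable (fun x ↦ partialV w u x ^ 2) volume v₁ b :=
    (hEc.pow 2).intervalIntegrable _ _
  have i2 : IntervalIntegrable (fun x ↦ w u x ^ 2) volume v₁ b := (hwc.pow 2).intervalIntegrable _ _
  calc |∫ x in v₁..b, 2 * partialV w u x * (efPotential M r u x * w u x)|
      ≤ ∫ x in v₁..b, |2 * partialV w u x * (efPotential M r u x * w u x)| :=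
        intervalIntegral.abs_integral_le_integral_abs hb
    _ ≤ ∫ x in v₁..b, K * (partialV w u x ^ 2 + w u x ^ 2) := by
        have i3 : IntervalIntegrable
            (fun x ↦ |2 * partialV w u x * (efPotential M r u x * w u x)|) volume v₁ b :=
          (((hEc.const_mul 2).mul (hVc.mul hwc)).abs).intervalIntegrable _ _
        have i4 : IntervalIntegrable (fun x ↦ K * (partialV w u x ^ 2 + w u x ^ 2)) volume v₁ b :=
          (i1.add i2).const_mul K
        refine intervalIntegral.integral_mono_on hb i3 i4 fun x hx ↦ ?_
        · have hV : |efPotential M r u x| ≤ K := abs_efPotential_le_bound hM hr u hx.1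
          have h2 : 2 * |partialV w u x| * |w u x| ≤ |partialV w u x| ^ 2 + |w u x| ^ 2 :=
            two_mul_le_add_sq _ _
          rw [sq_abs, sq_abs] at h2
          calc |2 * partialV w u x * (efPotential M r u x * w u x)|
              = |efPotential M r u x| * (2 * |partialV w u x| * |w u x|) := by
                simp only [abs_mul, abs_two]; ring
            _ ≤ K * (partialV w u x ^ 2 + w u x ^ 2) := by
                gcongr
    _ = K * (nullSliceEnergy w v₁ b u + ∫ x in v₁..b, w u x ^ 2) := by
        rw [intervalIntegral.integral_const_mul, intervalIntegral.integral_add i1 i2]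
        rfl
    _ ≤ K * (nullSliceEnergy w v₁ b u + (b - v₁) * ((b - v₁) * nullSliceEnergy w v₁ b u)) := by
        have i5 : IntervalIntegrable (fun _ ↦ (b - v₁) * nullSliceEnergy w v₁ b u) volume v₁ b :=
          intervalIntegrable_const
        have hint : ∫ x in v₁..b, w u x ^ 2 ≤ (b - v₁) * ((b - v₁) * nullSliceEnergy w v₁ b u) := by
          have := intervalIntegral.integral_mono_on hb i2 i5
            (fun x hx ↦ hw.sq_le_mul_nullSliceEnergy hz u hx)
          rwa [intervalIntegral.integral_const, smul_eq_mul] at this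
        exact mul_le_mul_of_nonneg_left (by linarith) hK0
    _ = (1 + (b - v₁) ^ 2) * K * nullSliceEnergy w v₁ b u := by ring

/-- Backward Grönwall, first half: `Ψ_b` is bounded towards the past (`Ψ_b e^{cP}` is
non-decreasing in `u`, and `P ≥ 0`). [folklore] -/
lemma nullSliceEnergy_bounded (hM : 0 < M) (hr : IsEFAreaRadius M r)
    (hw : IsRadiationFieldOnSchwarzschild M r w) (hz : ∀ u v, v ≤ v₁ → w u v = 0) {b : ℝ}
    (hb : v₁ ≤ b) (u₀ : ℝ) :
    ∃ B, 0 ≤ B ∧ ∀ u ≤ u₀, nullSliceEnergy w v₁ b u ≤ B := by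
  set c := 1 + (b - v₁) ^ 2 with hc
  set Θ := fun u ↦ nullSliceEnergy w v₁ b u * Real.exp (c * efWeight M r v₁ u) with hΘ
  have hderiv : ∀ u, HasDerivAt Θ
      ((∫ x in v₁..b, 2 * partialV w u x * (efPotential M r u x * w u x)) *
          Real.exp (c * efWeight M r v₁ u) +
        nullSliceEnergy w v₁ b u * (Real.exp (c * efWeight M r v₁ u) *
          (c * efPotentialBound M r v₁ u))) u := fun u ↦
    (hasDerivAt_nullSliceEnergy hM hr hw b u).mul ((hasDerivAt_efWeight hM hr u).const_mul c).exp
  have hmono : Monotone Θ := by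
    refine monotone_of_deriv_nonneg (fun u ↦ (hderiv u).differentiableAt) fun u ↦ ?_
    rw [(hderiv u).deriv]
    have h1 := abs_deriv_nullSliceEnergy_le hM hr hw hz hb u
    have h2 := neg_abs_le (∫ x in v₁..b, 2 * partialV w u x * (efPotential M r u x * w u x))
    have hexp := Real.exp_pos (c * efWeight M r v₁ u)
    have hΨ := nullSliceEnergy_nonneg (w := w) hb u
    nlinarith [h1, h2, hexp, hΨ]
  refine ⟨Θ u₀, ?_, fun u hu ↦ ?_⟩
  · exact mul_nonneg (nullSliceEnergy_nonneg (w := w) hb u₀) (Real.exp_pos _).le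
  · have h1 : Θ u ≤ Θ u₀ := hmono hu
    have h2 : nullSliceEnergy w v₁ b u ≤ Θ u := by
      have hexp : 1 ≤ Real.exp (c * efWeight M r v₁ u) :=
        Real.one_le_exp (mul_nonneg (by positivity) (efWeight_nonneg hM hr u))
      have hΨ := nullSliceEnergy_nonneg (w := w) hb u
      simp only [hΘ]
      nlinarith
    exact h2.trans h1

/-- Backward Grönwall, second half: `Ψ_b(u) ≤ Ψ_b(u') e^{c P(u)}` for `u' ≤ u` (`Ψ_b e^{−cP}` is
non-increasing in `u`). [folklore] -/
lemma nullSliceEnergy_le_of_le (hM : 0 < M) (hr : IsEFAreaRadius M r)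
    (hw : IsRadiationFieldOnSchwarzschild M r w) (hz : ∀ u v, v ≤ v₁ → w u v = 0) {b : ℝ}
    (hb : v₁ ≤ b) {u' u : ℝ} (hu : u' ≤ u) : nullSliceEnergy w v₁ b u ≤
      nullSliceEnergy w v₁ b u' * Real.exp ((1 + (b - v₁) ^ 2) * efWeight M r v₁ u) := by
  set c := 1 + (b - v₁) ^ 2 with hc
  set Θ := fun u ↦ nullSliceEnergy w v₁ b u * Real.exp (-(c * efWeight M r v₁ u)) with hΘ
  have hderiv : ∀ u, HasDerivAt Θ
      ((∫ x in v₁..b, 2 * partialV w u x * (efPotential M r u x * w u x)) *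
          Real.exp (-(c * efWeight M r v₁ u)) +
        nullSliceEnergy w v₁ b u * (Real.exp (-(c * efWeight M r v₁ u)) *
          (-(c * efPotentialBound M r v₁ u)))) u := fun u ↦
    (hasDerivAt_nullSliceEnergy hM hr hw b u).mul ((hasDerivAt_efWeight hM hr u).const_mul c).neg.exp
  have hanti : Antitone Θ := by
    refine antitone_of_deriv_nonpos (fun u ↦ (hderiv u).differentiableAt) fun u ↦ ?_
    rw [(hderiv u).deriv]
    have h1 := abs_deriv_nullSliceEnergy_le hM hr hw hz hb u
    have h2 := le_abs_self (∫ x in v₁..b, 2 * partialV w u x * (efPotential M r u x * w u x))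
    have hexp := Real.exp_pos (-(c * efWeight M r v₁ u))
    have hΨ := nullSliceEnergy_nonneg (w := w) hb u
    nlinarith [h1, h2, hexp, hΨ]
  have h1 : Θ u ≤ Θ u' := hanti hu
  simp only [hΘ] at h1
  have hexp1 : Real.exp (-(c * efWeight M r v₁ u')) ≤ 1 := by
    rw [Real.exp_le_one_iff]
    exact neg_nonpos.2 (mul_nonneg (by positivity) (efWeight_nonneg hM hr u'))
  have hΨ' := nullSliceEnergy_nonneg (w := w) hb u'
  have h2 : nullSliceEnergy w v₁ b u' * Real.exp (-(c * efWeight M r v₁ u')) ≤ nullSliceEnergy w v₁ b u' :=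
    mul_le_of_le_one_right hΨ' hexp1
  have h3 : nullSliceEnergy w v₁ b u * Real.exp (-(c * efWeight M r v₁ u)) ≤ nullSliceEnergy w v₁ b u' :=
    h1.trans h2
  have hexp := Real.exp_pos (c * efWeight M r v₁ u)
  calc nullSliceEnergy w v₁ b u
      = nullSliceEnergy w v₁ b u * Real.exp (-(c * efWeight M r v₁ u)) *
          Real.exp (c * efWeight M r v₁ u) := by
        rw [mul_assoc, ← Real.exp_add, neg_add_cancel, Real.exp_zero, mul_one]
    _ ≤ nullSliceEnergy w v₁ b u' * Real.exp (c * efWeight M r v₁ u) :=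
        mul_le_mul_of_nonneg_right h3 hexp.le

/-- **Uniform Cauchy property of `∂ᵥw` towards `𝓘⁻`.** If `Ψ_{b'} ≤ B` on `(−∞, u₀]`, then with
`W₀ = √((b' − v₁)B)` one has `|w| ≤ W₀` there (Cauchy–Schwarz), hence `|∂ᵤ∂ᵥw| = |V w| ≤ W₀ K`
and `|∂ᵥw(u, x) − ∂ᵥw(u', x)| ≤ W₀ (P(u) − P(u'))` for `u' ≤ u ≤ u₀`, `x ∈ [v₁, b']` (monotonicity
of `∂ᵥw(·, x) ∓ W₀ P`). [folklore] -/
lemma abs_partialV_sub_le (hM : 0 < M) (hr : IsEFAreaRadius M r)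
    (hw : IsRadiationFieldOnSchwarzschild M r w) (hz : ∀ u v, v ≤ v₁ → w u v = 0) {b' : ℝ}
    (hb' : v₁ ≤ b') {u₀ B : ℝ} (hB : ∀ s ≤ u₀, nullSliceEnergy w v₁ b' s ≤ B) {x : ℝ}
    (hx : x ∈ Icc v₁ b') {u' u : ℝ} (hu' : u' ≤ u) (hu : u ≤ u₀) :
    |partialV w u x - partialV w u' x| ≤
      Real.sqrt ((b' - v₁) * B) * (efWeight M r v₁ u - efWeight M r v₁ u') := by
  set W₀ := Real.sqrt ((b' - v₁) * B) with hW₀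
  have hW₀0 : 0 ≤ W₀ := Real.sqrt_nonneg _
  -- `|w| ≤ W₀` on `(−∞, u₀] × [v₁, b']`
  have hwB : ∀ s ≤ u₀, |w s x| ≤ W₀ := by
    intro s hs
    refine Real.abs_le_sqrt ?_
    exact (hw.sq_le_mul_nullSliceEnergy hz s hx).trans
      (mul_le_mul_of_nonneg_left (hB s hs) (sub_nonneg.2 hb'))
  -- the derivative bound `|V w| ≤ K W₀` for `s ≤ u₀`
  have hVw : ∀ s ≤ u₀, |efPotential M r s x * w s x| ≤ efPotentialBound M r v₁ s * W₀ := by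
    intro s hs
    rw [abs_mul]
    exact mul_le_mul (abs_efPotential_le_bound hM hr s hx.1) (hwB s hs) (abs_nonneg _)
      (efPotentialBound_nonneg hM hr s)
  -- `E(·, x) − W₀ P` is non-increasing on `(−∞, u₀]`
  have hd₁ : ∀ s, HasDerivAt (fun s ↦ partialV w s x - W₀ * efWeight M r v₁ s)
      (efPotential M r s x * w s x - W₀ * efPotentialBound M r v₁ s) s := fun s ↦
    (hw.hasDerivAt_partialV_fst s x).sub ((hasDerivAt_efWeight hM hr s).const_mul W₀)
  have hanti : AntitoneOn (fun s ↦ partialV w s x - W₀ * efWeight M r v₁ s) (Iic u₀) := by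
    refine antitoneOn_of_deriv_nonpos (convex_Iic u₀)
      (fun s _ ↦ (hd₁ s).continuousAt.continuousWithinAt)
      (fun s _ ↦ (hd₁ s).differentiableAt.differentiableWithinAt) fun s hs ↦ ?_
    rw [interior_Iic] at hs
    rw [(hd₁ s).deriv]
    have := (le_abs_self _).trans (hVw s (le_of_lt hs))
    linarith
  -- `E(·, x) + W₀ P` is non-decreasing on `(−∞, u₀]`
  have hd₂ : ∀ s, HasDerivAt (fun s ↦ partialV w s x + W₀ * efWeight M r v₁ s)
      (efPotential M r s x * w s x + W₀ * efPotentialBound M r v₁ s) s := fun s ↦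
    (hw.hasDerivAt_partialV_fst s x).add ((hasDerivAt_efWeight hM hr s).const_mul W₀)
  have hmono : MonotoneOn (fun s ↦ partialV w s x + W₀ * efWeight M r v₁ s) (Iic u₀) := by
    refine monotoneOn_of_deriv_nonneg (convex_Iic u₀)
      (fun s _ ↦ (hd₂ s).continuousAt.continuousWithinAt)
      (fun s _ ↦ (hd₂ s).differentiableAt.differentiableWithinAt) fun s hs ↦ ?_
    rw [interior_Iic] at hs
    rw [(hd₂ s).deriv]
    have h' : -(efPotentialBound M r v₁ s * W₀) ≤ efPotential M r s x * w s x := by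
      have := neg_abs_le (efPotential M r s x * w s x)
      linarith [hVw s (le_of_lt hs)]
    linarith
  have h₁ := hanti (show u' ∈ Iic u₀ from hu'.trans hu) (show u ∈ Iic u₀ from hu) hu'
  have h₂ := hmono (show u' ∈ Iic u₀ from hu'.trans hu) (show u ∈ Iic u₀ from hu) hu'
  simp only at h₁ h₂
  rw [abs_le]
  constructor <;> nlinarith [h₁, h₂]

/-- **Pointwise smallness of `∂ᵥw` towards `𝓘⁻`.** If moreover `w(·, y) → 0` as `u → −∞` for
every `y`, then `|∂ᵥw(u, x)| ≤ W P(u)` on `(−∞, u₀] × [v₁, b]` for some constant `W`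
(`abs_le_of_primitive_tendsto_zero` applied to `e = ∂ᵥw`, `F = w`). [folklore] -/
lemma abs_partialV_le (hM : 0 < M) (hr : IsEFAreaRadius M r)
    (hw : IsRadiationFieldOnSchwarzschild M r w) (hz : ∀ u v, v ≤ v₁ → w u v = 0)
    (hlim : ∀ y, Tendsto (fun u ↦ w u y) atBot (𝓝 0)) {b : ℝ} (hb : v₁ ≤ b) (u₀ : ℝ) :
    ∃ W, 0 ≤ W ∧ ∀ u ≤ u₀, ∀ x ∈ Icc v₁ b, |partialV w u x| ≤ W * efWeight M r v₁ u := by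
  have hb1 : v₁ ≤ b + 1 := by linarith
  obtain ⟨B, -, hB⟩ := hw.nullSliceEnergy_bounded hM hr hz hb1 u₀
  refine ⟨Real.sqrt ((b + 1 - v₁) * B), Real.sqrt_nonneg _, fun u hu x hx ↦ ?_⟩
  set W := Real.sqrt ((b + 1 - v₁) * B) with hW
  have hW0 : 0 ≤ W := Real.sqrt_nonneg _
  have hEc : ∀ u', Continuous (partialV w u') := fun u' ↦ hw.continuous_partialV_snd u'
  refine abs_le_of_primitive_tendsto_zero (e := partialV w) (F := w) one_pos hEc
    (fun u' hu' y hy ↦ ?_) (fun u' _ y _ ↦ ?_) (fun y _ ↦ hlim y)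
  · have hy : y ∈ Icc v₁ (b + 1) := ⟨hx.1.trans hy.1, hy.2.trans (by linarith [hx.2])⟩
    have h := hw.abs_partialV_sub_le hM hr hz hb1 hB hy hu' hu
    rw [abs_sub_comm]
    refine h.trans ?_
    rw [← hW]
    have hP' := efWeight_nonneg hM hr (v₁ := v₁) u'
    nlinarith [hP', hW0]
  · rw [hw.eq_integral_partialV hz u' y, hw.eq_integral_partialV hz u' x]
    exact intervalIntegral.integral_interval_sub_left ((hEc u').intervalIntegrable _ _)
      ((hEc u').intervalIntegrable _ _)

/-- **A radiation field with no incoming radiation from `𝓗⁻` and trivial data on `𝓘⁻`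
vanishes identically.** If `ψ` is a smooth solution of `∂ᵤ∂ᵥψ = −2M(1 − 2M/r)ψ/r³` on the
Schwarzschild exterior (`M > 0`, EF double null gauge) with `ψ = 0` on `{v ≤ v₁}` and
`ψ(u, v) → 0` as `u → −∞` for every `v`, then `ψ = 0`. Proof: backward Grönwall for the slice
energies `Ψ_b(u) = ∫_{v₁}^{b} (∂ᵥψ)²` (`|Ψ_b'| ≤ (1 + (b − v₁)²) K Ψ_b`, `∫^{u} K = P(u) → 0` at `𝓘⁻`)
gives boundedness of `Ψ_b` towards the past, hence uniform smallness `|∂ᵥψ| ≤ W P(u)` (using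
the pointwise decay of `ψ`), hence `Ψ_b(u) → 0` as `u → −∞`, and then `Ψ_b ≡ 0` by the second
Grönwall inequality `Ψ_b(u) ≤ Ψ_b(u') e^{cP(u)}`. [folklore] -/
theorem eq_zero_of_tendsto_zero (hM : 0 < M) (hr : IsEFAreaRadius M r)
    (hw : IsRadiationFieldOnSchwarzschild M r w) (hz : ∀ u v, v ≤ v₁ → w u v = 0)
    (hlim : ∀ v, Tendsto (fun u ↦ w u v) atBot (𝓝 0)) (u v : ℝ) : w u v = 0 := by
  rcases le_or_gt v v₁ with hv | hv
  · exact hz u v hv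
  have hb : v₁ ≤ v := hv.le
  obtain ⟨W, hW0, hW⟩ := hw.abs_partialV_le hM hr hz hlim hb u
  -- `Ψ_v(s) ≤ (v - v₁) (W P(s))²` for `s ≤ u`
  have hΨle : ∀ s ≤ u, nullSliceEnergy w v₁ v s ≤ (v - v₁) * (W * efWeight M r v₁ s) ^ 2 := by
    intro s hs
    have i1 : IntervalIntegrable (fun x ↦ partialV w s x ^ 2) volume v₁ v :=
      ((hw.continuous_partialV_snd s).pow 2).intervalIntegrable _ _
    have i2 : IntervalIntegrable (fun _ ↦ (W * efWeight M r v₁ s) ^ 2) volume v₁ v :=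
      intervalIntegrable_const
    have := intervalIntegral.integral_mono_on hb i1 i2 fun x hx ↦ ?_
    · rwa [intervalIntegral.integral_const, smul_eq_mul] at this
    · rw [← sq_abs (partialV w s x)]
      exact pow_le_pow_left₀ (abs_nonneg _) (hW s hs x hx) 2
  -- hence `Ψ_v(s) → 0` as `s → -∞`
  have hΨ0 : Tendsto (nullSliceEnergy w v₁ v) atBot (𝓝 0) := by
    have hup : Tendsto (fun s ↦ (v - v₁) * (W * efWeight M r v₁ s) ^ 2) atBot
        (𝓝 ((v - v₁) * (W * 0) ^ 2)) :=
      (((tendsto_efWeight_atBot hM hr).const_mul W).pow 2).const_mul (v - v₁)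
    rw [mul_zero, zero_pow two_ne_zero, mul_zero] at hup
    refine tendsto_of_tendsto_of_tendsto_of_le_of_le' tendsto_const_nhds hup ?_ ?_
    · exact Eventually.of_forall fun s ↦ nullSliceEnergy_nonneg (w := w) hb s
    · exact (eventually_le_atBot u).mono fun s hs ↦ hΨle s hs
  -- and `Ψ_v(u) ≤ Ψ_v(s) e^{cP(u)} → 0`
  have hΨu : nullSliceEnergy w v₁ v u ≤ 0 := by
    have hT : Tendsto (fun s ↦ nullSliceEnergy w v₁ v s *
        Real.exp ((1 + (v - v₁) ^ 2) * efWeight M r v₁ u)) atBot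
        (𝓝 (0 * Real.exp ((1 + (v - v₁) ^ 2) * efWeight M r v₁ u))) := hΨ0.mul_const _
    rw [zero_mul] at hT
    exact ge_of_tendsto hT ((eventually_le_atBot u).mono fun s hs ↦
      hw.nullSliceEnergy_le_of_le hM hr hz hb hs)
  have hΨeq : nullSliceEnergy w v₁ v u = 0 := le_antisymm hΨu (nullSliceEnergy_nonneg (w := w) hb u)
  have hsq := hw.sq_le_mul_nullSliceEnergy hz u (x := v) ⟨hb, le_rfl⟩
  rw [hΨeq, mul_zero] at hsq
  exact pow_eq_zero_iff two_ne_zero |>.1 (le_antisymm hsq (sq_nonneg _))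

/-- **Uniqueness of the scattering solution (in the class used by the named facts).** Two smooth
radiation fields on the Schwarzschild exterior of mass `M > 0` (same EF area radius `r`) which
both vanish on `{v ≤ v₁}` (no incoming radiation from `𝓗⁻`, Schwarzschildean/trivial past) and
attain the same data `G` on `𝓘⁻` pointwise, `ψᵢ(u, v) → G(v)` as `u → −∞`, coincide. In
particular the radiation field whose existence `KehrbergerLogarithmicAsymptotics[Corrected]`
asserts is unique, so these existential facts are statements about THE scattering solution
(Kehrberger, arXiv:2105.08079v3, Thm. 6.2: "there exists a unique smooth scattering solution
[...] with the uniqueness being understood in the class of finite-energy solutions", after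
Dafermos–Rodnianski–Shlapentokh-Rothman; here no energy assumption is needed because the data
class is smooth with pointwise limits and the problem is `1+1`-dimensional). [folklore] -/
theorem unique (hM : 0 < M) (hr : IsEFAreaRadius M r) {ψ₁ ψ₂ : ℝ → ℝ → ℝ}
    (h₁ : IsRadiationFieldOnSchwarzschild M r ψ₁) (h₂ : IsRadiationFieldOnSchwarzschild M r ψ₂)
    (hz₁ : ∀ u v, v ≤ v₁ → ψ₁ u v = 0) (hz₂ : ∀ u v, v ≤ v₁ → ψ₂ u v = 0) {G : ℝ → ℝ}
    (hG₁ : ∀ v, Tendsto (fun u ↦ ψ₁ u v) atBot (𝓝 (G v)))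
    (hG₂ : ∀ v, Tendsto (fun u ↦ ψ₂ u v) atBot (𝓝 (G v))) : ψ₁ = ψ₂ := by
  have hw := h₁.sub h₂
  have hz : ∀ u v, v ≤ v₁ → (ψ₁ - ψ₂) u v = 0 := fun u v hv ↦ by
    simp [hz₁ u v hv, hz₂ u v hv]
  have hlim : ∀ v, Tendsto (fun u ↦ (ψ₁ - ψ₂) u v) atBot (𝓝 0) := fun v ↦ by
    have := (hG₁ v).sub (hG₂ v)
    rw [sub_self] at this
    simpa using this
  funext u v
  have := hw.eq_zero_of_tendsto_zero hM hr hz hlim u v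
  simpa [sub_eq_zero] using this

end IsRadiationFieldOnSchwarzschild

end Uniqueness

/-! ### Existence of an EF area radius (the inverse tortoise coordinate) -/

/-- The tortoise coordinate as a function of `s = log(r − 2M)`:
`T(s) = r + 2M log(r − 2M) = 2M + eˢ + 2M s`. [folklore] -/
def efTortoise (M : ℝ) (s : ℝ) : ℝ := 2 * M + Real.exp s + 2 * M * s

/-- `T'(s) = eˢ + 2M`. [folklore] -/
lemma hasDerivAt_efTortoise (M s : ℝ) :
    HasDerivAt (efTortoise M) (Real.exp s + 2 * M) s := by
  have h := ((hasDerivAt_const s (2 * M)).add (Real.hasDerivAt_exp s)).add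
    ((hasDerivAt_id s).const_mul (2 * M))
  refine h.congr_deriv ?_
  simp

/-- `T` is strictly increasing for `M > 0`. [folklore] -/
lemma strictMono_efTortoise {M : ℝ} (hM : 0 < M) : StrictMono (efTortoise M) :=
  strictMono_of_deriv_pos fun s ↦ by
    rw [(hasDerivAt_efTortoise M s).deriv]; positivity

/-- `T` is continuous. [folklore] -/
lemma continuous_efTortoise (M : ℝ) : Continuous (efTortoise M) := by
  unfold efTortoise; fun_prop

/-- `T` is onto `ℝ` (`T → ±∞` at `±∞`). [folklore] -/
lemma surjective_efTortoise {M : ℝ} (hM : 0 < M) : Function.Surjective (efTortoise M) := by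
  refine (continuous_efTortoise M).surjective ?_ ?_
  · -- `T → +∞`
    have h1 : Tendsto (fun s ↦ 2 * M + Real.exp s) atTop atTop :=
      tendsto_atTop_add_const_left _ _ Real.tendsto_exp_atTop
    have h2 : Tendsto (fun s : ℝ ↦ 2 * M * s) atTop atTop :=
      tendsto_id.const_mul_atTop (by positivity)
    exact h1.atTop_add_atTop h2
  · -- `T → −∞`
    have h1 : Tendsto (fun s ↦ 2 * M + Real.exp s) atBot (𝓝 (2 * M + 0)) :=
      tendsto_const_nhds.add Real.tendsto_exp_atBot
    have h2 : Tendsto (fun s : ℝ ↦ 2 * M * s) atBot atBot :=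
      tendsto_id.const_mul_atBot (by positivity)
    exact h1.add_atBot h2

/-- The inverse `σ = T⁻¹ : ℝ → ℝ` of the tortoise coordinate (an order isomorphism). [folklore] -/
def efTortoiseInv {M : ℝ} (hM : 0 < M) : ℝ ≃o ℝ :=
  (StrictMono.orderIsoOfSurjective (efTortoise M) (strictMono_efTortoise hM)
    (surjective_efTortoise hM)).symm

/-- `T(T⁻¹(x)) = x`. [folklore] -/
lemma efTortoise_efTortoiseInv {M : ℝ} (hM : 0 < M) (x : ℝ) :
    efTortoise M (efTortoiseInv hM x) = x :=
  (StrictMono.orderIsoOfSurjective (efTortoise M) (strictMono_efTortoise hM)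
    (surjective_efTortoise hM)).apply_symm_apply x

/-- `(T⁻¹)'(x) = 1/T'(T⁻¹ x)` (inverse function rule). [folklore] -/
lemma hasDerivAt_efTortoiseInv {M : ℝ} (hM : 0 < M) (x : ℝ) :
    HasDerivAt (efTortoiseInv hM) (Real.exp (efTortoiseInv hM x) + 2 * M)⁻¹ x :=
  HasDerivAt.of_local_left_inverse (efTortoiseInv hM).continuous.continuousAt
    (hasDerivAt_efTortoise M _) (by positivity) (Eventually.of_forall (efTortoise_efTortoiseInv hM))

/-- **The standard EF area radius** `r(u, v) = 2M + exp(T⁻¹(v − u))`, i.e. the solution of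
`r + 2M log(r − 2M) = r* = v − u`. [folklore] -/
def stdEFAreaRadius {M : ℝ} (hM : 0 < M) (u v : ℝ) : ℝ := 2 * M + Real.exp (efTortoiseInv hM (v - u))

/-- `d/dx (2M + exp(T⁻¹ x)) = 1 − 2M/(2M + exp(T⁻¹ x))`. [folklore] -/
lemma hasDerivAt_stdEFAreaRadius_aux {M : ℝ} (hM : 0 < M) (x : ℝ) :
    HasDerivAt (fun x ↦ 2 * M + Real.exp (efTortoiseInv hM x))
      (1 - 2 * M / (2 * M + Real.exp (efTortoiseInv hM x))) x := by
  have h := ((hasDerivAt_efTortoiseInv hM x).exp).const_add (2 * M)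
  refine h.congr_deriv ?_
  have hpos : 0 < Real.exp (efTortoiseInv hM x) + 2 * M := by positivity
  field_simp
  ring

/-- **The standard EF area radius is an EF area radius**: `r > 2M`, `∂ᵥr = 1 − 2M/r = −∂ᵤr`
("`2u = t − r*`, `2v = t + r*`", Kehrberger, §3.2). [cite: Kehrberger2022AHP, §3.2] -/
theorem isEFAreaRadius_stdEFAreaRadius {M : ℝ} (hM : 0 < M) :
    IsEFAreaRadius M (stdEFAreaRadius hM) := by
  refine ⟨fun u v ↦ ?_, fun u v ↦ ?_, fun u v ↦ ?_⟩
  · simp only [stdEFAreaRadius]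
    linarith [Real.exp_pos (efTortoiseInv hM (v - u))]
  · have h := (hasDerivAt_stdEFAreaRadius_aux hM (v - u)).comp v
      ((hasDerivAt_id v).sub_const u)
    simp only [stdEFAreaRadius]
    refine (h.congr_of_eventuallyEq (Eventually.of_forall fun v' ↦ rfl)).congr_deriv ?_
    simp
  · have h := (hasDerivAt_stdEFAreaRadius_aux hM (v - u)).comp u
      ((hasDerivAt_const u v).sub (hasDerivAt_id u))
    simp only [stdEFAreaRadius]
    refine (h.congr_of_eventuallyEq (Eventually.of_forall fun u' ↦ rfl)).congr_deriv ?_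
    simp

/-- For every `M > 0` there is an EF area radius (non-vacuity of the hypothesis
`IsEFAreaRadius M r` of the named facts). [folklore] -/
theorem exists_isEFAreaRadius {M : ℝ} (hM : 0 < M) : ∃ r, IsEFAreaRadius M r :=
  ⟨stdEFAreaRadius hM, isEFAreaRadius_stdEFAreaRadius hM⟩

/-! ### Admissible scattering data exist -/

/-- A smooth bump supported in `[1/4, 3/4] ⊆ (0, 1)` with positive integral: admissible scattering
data with `n = 0` (`I⁽⁰⁾[G] = M ∫ G ≠ 0`). [folklore] -/
def scatteringBumpData : ContDiffBump (1 / 2 : ℝ) := ⟨1 / 8, 1 / 4, by norm_num, by norm_num⟩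

/-- The bump data are smooth. [folklore] -/
lemma scatteringBumpData_contDiff : ContDiff ℝ ((⊤ : ℕ∞) : WithTop ℕ∞) (scatteringBumpData : ℝ → ℝ) :=
  scatteringBumpData.contDiff

/-- The bump data are supported in `[1/4, 3/4] ⊆ (0, 1)`. [folklore] -/
lemma tsupport_scatteringBumpData_subset : tsupport (scatteringBumpData : ℝ → ℝ) ⊆ Ioo 0 1 := by
  rw [scatteringBumpData.tsupport_eq, Real.closedBall_eq_Icc]
  refine Icc_subset_Ioo ?_ ?_ <;> norm_num [scatteringBumpData]

/-- The zeroth moment `I⁽⁰⁾[G] = M ∫ G` of the bump data is non-zero for `M ≠ 0`. [folklore] -/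
lemma kehrbergerMoment_scatteringBumpData_zero_ne {M : ℝ} (hM : M ≠ 0) :
    kehrbergerMoment M scatteringBumpData 0 ≠ 0 := by
  rw [kehrbergerMoment_zero]
  exact mul_ne_zero hM (scatteringBumpData.integral_pos (μ := volume)).ne'

/-! ### The journal-sign statement is refuted by the corrected one -/

-- `KehrbergerLogarithmicAsymptotics` is `@[deprecated]` in `NonSmoothNullInfinity.lean` (mis-stated,
-- refuted; verdict clean-up 2026-08-15) and its refutation below must name it;
-- REMOVE-WHEN the deprecated def is deleted.
set_option linter.deprecated false in
/-- **`KehrbergerLogarithmicAsymptotics` (journal sign of (6.18)) and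
`KehrbergerLogarithmicAsymptoticsCorrected` (arXiv-v3 sign) cannot both hold; in particular the
corrected fact REFUTES the declaration `KehrbergerLogarithmicAsymptotics`.** Instantiate both at
`M = 1`, the standard EF area radius, bump data `G` with `∫ G > 0` and `n = 0`; the two radiation
fields they provide coincide by `IsRadiationFieldOnSchwarzschild.unique` (same equation, both
vanish on `{v ≤ v₁}`, same pointwise data on `𝓘⁻`), and for `u < min U₁ U₂` the two expansions
of `∂ᵥψ(u, ·)` carry the opposite non-zero logarithmic coefficients `±3! I⁽⁰⁾[G] M`, which
`KehrbergerLogarithmicAsymptotics.clause_two_exclusive` excludes. This is the formal content of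
the erratum recorded in `NonSmoothNullInfinity.lean`: the fact to use (and, eventually, to
discharge) is `KehrbergerLogarithmicAsymptoticsCorrected`; `KehrbergerLogarithmicAsymptotics_holds`
can never be proved unless the corrected theorem of the source is false. [folklore] -/
theorem KehrbergerLogarithmicAsymptotics.not_of_corrected
    (hcorr : KehrbergerLogarithmicAsymptoticsCorrected) : ¬ KehrbergerLogarithmicAsymptotics := by
  intro hold
  have hM : (0 : ℝ) < 1 := one_pos
  set r := stdEFAreaRadius hM with hrdef
  have hr : IsEFAreaRadius 1 r := isEFAreaRadius_stdEFAreaRadius hM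
  set G : ℝ → ℝ := (scatteringBumpData : ℝ → ℝ) with hGdef
  have hG : ContDiff ℝ ((⊤ : ℕ∞) : WithTop ℕ∞) G := scatteringBumpData_contDiff
  have hsupp : tsupport G ⊆ Ioo 0 1 := tsupport_scatteringBumpData_subset
  have hlt : ∀ k < 0, kehrbergerMoment 1 G k = 0 := fun k hk ↦ absurd hk (Nat.not_lt_zero k)
  have hn : kehrbergerMoment 1 G 0 ≠ 0 := kehrbergerMoment_scatteringBumpData_zero_ne one_ne_zero
  obtain ⟨ψ₁, hψ₁, hz₁, hd₁, U₁, -, -, f, -, hexp₁⟩ :=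
    hold 1 hM r hr G 0 1 one_pos hG hsupp 0 hlt hn
  obtain ⟨ψ₂, hψ₂, hz₂, hd₂, U₂, -, -, g, -, hexp₂⟩ :=
    hcorr 1 hM r hr G 0 1 one_pos hG hsupp 0 hlt hn
  have heq : ψ₁ = ψ₂ := hψ₁.unique hM hr hψ₂ hz₁ hz₂ hd₁ hd₂
  subst heq
  set u := min U₁ U₂ - 1 with hu
  have hu₁ : u < U₁ := by have := min_le_left U₁ U₂; linarith
  have hu₂ : u < U₂ := by have := min_le_right U₁ U₂; linarith
  set c : ℝ := (-1 : ℝ) ^ 0 * ((0 + 3).factorial : ℝ) * kehrbergerMoment 1 G 0 * 1 with hcdef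
  have hc : c ≠ 0 := by
    rw [hcdef]
    refine mul_ne_zero (mul_ne_zero (mul_ne_zero (by norm_num) ?_) hn) one_ne_zero
    exact_mod_cast (Nat.factorial_pos _).ne'
  exact KehrbergerLogarithmicAsymptotics.clause_two_exclusive hM.le hr hc (hexp₁ u hu₁) (hexp₂ u hu₂)

-- as above: the statement must name the deprecated constant; REMOVE-WHEN it is deleted.
set_option linter.deprecated false in
/-- Equivalently: the two declarations are jointly inconsistent. [folklore] -/
theorem KehrbergerLogarithmicAsymptotics.not_and_corrected :
    ¬ (KehrbergerLogarithmicAsymptotics ∧ KehrbergerLogarithmicAsymptoticsCorrected) :=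
  fun h ↦ KehrbergerLogarithmicAsymptotics.not_of_corrected h.2 h.1


/-! ### Corollaries for the corrected fact: uniqueness of its radiation field, and the journal-sign
expansion fails for every admissible datum -/

/-- **Under the corrected fact, the journal-sign expansion fails for EVERY admissible datum and for
THE scattering solution.** For `M > 0`, an EF area radius `r`, admissible data `G` (smooth,
supported in `(v₁, v₂)`, first non-vanishing moment `I⁽ⁿ⁾[G]`) and ANY radiation field `ψ` vanishing
on `{v ≤ v₁}` with data `G` on `𝓘⁻` (by `IsRadiationFieldOnSchwarzschild.unique` this is the
radiation field of `KehrbergerLogarithmicAsymptoticsCorrected`), there is `U₀` such that for every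
`u < U₀` and every choice of coefficients `f₀, …, fₙ` the expansion of `∂ᵥψ(u, ·)` with the
journal sign `+(−1)ⁿ(3+n)! I⁽ⁿ⁾[G] M` of the logarithmic term (clause (2) of
`KehrbergerLogarithmicAsymptotics`) is false. [folklore] -/
theorem KehrbergerLogarithmicAsymptoticsCorrected.not_journalSign_expansion
    (h : KehrbergerLogarithmicAsymptoticsCorrected) {M : ℝ} (hM : 0 < M) {r : ℝ → ℝ → ℝ}
    (hr : IsEFAreaRadius M r) {G : ℝ → ℝ} {v₁ v₂ : ℝ} (hv : v₁ < v₂)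
    (hG : ContDiff ℝ ((⊤ : ℕ∞) : WithTop ℕ∞) G) (hsupp : tsupport G ⊆ Ioo v₁ v₂)
    {n : ℕ} (hlt : ∀ k < n, kehrbergerMoment M G k = 0) (hn : kehrbergerMoment M G n ≠ 0)
    {ψ : ℝ → ℝ → ℝ} (hψ : IsRadiationFieldOnSchwarzschild M r ψ)
    (hz : ∀ u v, v ≤ v₁ → ψ u v = 0) (hd : ∀ v, Tendsto (fun u ↦ ψ u v) atBot (𝓝 (G v))) :
    ∃ U₀ : ℝ, U₀ < -1 ∧ ∀ u, u < U₀ → ∀ f : ℕ → ℝ,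
      ¬ (fun v ↦ deriv (fun v' ↦ ψ u v') v -
            (∑ i ∈ Finset.range (n + 1), f i / r u v ^ (3 + i)) -
            (-1) ^ n * ((n + 3).factorial : ℝ) * kehrbergerMoment M G n * M *
              (Real.log (r u v) - Real.log |u|) / r u v ^ (4 + n))
          =O[atTop] (fun v ↦ 1 / r u v ^ (4 + n)) := by
  obtain ⟨ψ', hψ', hz', hd', U₀, hU₀, -, g, -, hexp⟩ := h M hM r hr G v₁ v₂ hv hG hsupp n hlt hn
  have heq : ψ' = ψ := hψ'.unique hM hr hψ hz' hz hd' hd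
  subst heq
  refine ⟨U₀, hU₀, fun u hu f hf ↦ ?_⟩
  set c : ℝ := (-1 : ℝ) ^ n * ((n + 3).factorial : ℝ) * kehrbergerMoment M G n * M with hcdef
  have hc : c ≠ 0 := by
    rw [hcdef]
    refine mul_ne_zero (mul_ne_zero (mul_ne_zero ?_ ?_) hn) hM.ne'
    · exact pow_ne_zero _ (by norm_num)
    · exact_mod_cast (Nat.factorial_pos _).ne'
  exact KehrbergerLogarithmicAsymptotics.clause_two_exclusive hM.le hr hc hf (hexp u hu)

/-- **The scattering solution of the corrected fact is unique**: under
`KehrbergerLogarithmicAsymptoticsCorrected`, for admissible data there is EXACTLY ONE radiation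
field vanishing on `{v ≤ v₁}` and attaining `G` on `𝓘⁻` (existence from the fact, uniqueness from
`IsRadiationFieldOnSchwarzschild.unique`). [cite: Kehrberger2022AHP, Thm. 6.2 (arXiv v3)] -/
theorem KehrbergerLogarithmicAsymptoticsCorrected.existsUnique
    (h : KehrbergerLogarithmicAsymptoticsCorrected) {M : ℝ} (hM : 0 < M) {r : ℝ → ℝ → ℝ}
    (hr : IsEFAreaRadius M r) {G : ℝ → ℝ} {v₁ v₂ : ℝ} (hv : v₁ < v₂)
    (hG : ContDiff ℝ ((⊤ : ℕ∞) : WithTop ℕ∞) G) (hsupp : tsupport G ⊆ Ioo v₁ v₂)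
    {n : ℕ} (hlt : ∀ k < n, kehrbergerMoment M G k = 0) (hn : kehrbergerMoment M G n ≠ 0) :
    ∃! ψ : ℝ → ℝ → ℝ, IsRadiationFieldOnSchwarzschild M r ψ ∧
      (∀ u v, v ≤ v₁ → ψ u v = 0) ∧ (∀ v, Tendsto (fun u ↦ ψ u v) atBot (𝓝 (G v))) := by
  obtain ⟨ψ, hψ, hz, hd, -⟩ := h M hM r hr G v₁ v₂ hv hG hsupp n hlt hn
  exact ⟨ψ, ⟨hψ, hz, hd⟩, fun ψ' ⟨hψ', hz', hd'⟩ ↦ hψ'.unique hM hr hψ hz' hz hd' hd⟩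

end Literature.Barriers.FinalStateConjecture

end
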